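import Summits.NavierStokesRegularity.FluidComputer.BlockRelReach
import Summits.NavierStokesRegularity.FluidComputer.BlockRelDrift

/-!
# Block line — a RELATIVE reach certificate for the quadratic transit gate: the relative residue
# of the two-wavelet quadratic transit design ALONE implies `¬ (Clay A)`

HONEST FRAMING: low prior, high value-of-information experiment on Tao's machine paradigm; NOT a
claim that NS blows up. The hypothesis `RelOpenReachBound …` of §2 is this lane's RESIDUE (the
unproved, presumably FALSE, Navier–Stokes-side claim about the two-wavelet design); nothing here is
evidence about Navier–Stokes.

WHY. `BlockRelReach.lean` assembled finite-time blow-up from (i) the residue in RELATIVE form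
`RelOpenReachBound 𝒟 P F U ε τc` (readout right-derivative within `ε (1 + ‖read‖)` of the design
field — the form NOT refuted by the viscous tests of `BlockReachViscous.lean` / `BlockReachProbe.lean`
/ `BlockReachVoid.lean` / `BlockPairCeiling.lean`, which kill every ABSOLUTE tolerance) and (ii) a
reach–avoid certificate robust to defects of that relative size,
`RelReachCertificate F U (relMod ε) τc (AinO P) (AoutO P)`, and left (ii) for the lane's design — the
quadratic transit gate `quadVF k η` on the loaded region, windows `Params.reg` — as the next design
item. A relative defect is HARDER to certify against than an absolute one
(`RelReachCertificate.toReachCertificate`); `BlockRelDrift.lean` supplies the amplitude-uniform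
transition theorem `rel_pseudoOrbit_datO`, and this file packages it.

WHAT IS PROVED ([folklore] throughout). §1 `quadRelReachCertificate`: the quadratic transit gate
inhabits the relative certificate interface (`η ∈ [1/2, 9/10]`, `k ≥ 6`, `0 ≤ ε ≤ 1/2500`; tube =
the energy band `quadTube η (4ε)`, REACH = `rel_pseudoOrbit_datO`). §2 hence the SINGLE structure
`RelOpenReachBound 𝒟 (Params.reg) (quadVF k η) (loadedRegion η) ε 1` implies
`¬ NavierStokesRegularity` (`ns_blowup_of_relQuadReachBound`) and the cascade theorem
(`energy_reaches_all_scales_of_relQuadReachBound`; tubes are energy bands, hence bounded). Whether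
that structure holds for two wavelets is the residue proper (presumably not: junk production
`B(ψ_n, ψ_n) ∉ span ψ_{n+1}`); its clock is constrained by `RelOpenReachBound.unit_le_quad`.
-/

noncomputable section

open MeasureTheory Set Filter Topology Metric
open scoped ENNReal NNReal SchwartzMap

namespace Summit.NavierStokesRegularity.FluidComputer

open Literature.Analysis.FluidPDE Literature.Analysis.FluidPDE.Tao2016
open Literature.Analysis.FluidPDE.FluidComputer
open Literature.Analysis.FunctionSpaces (eFourierSobolevNorm)
open Summit.NavierStokesRegularity.NavierStokesRegularity.Theorems.FluidComputer

namespace BlockDesign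

variable {𝒟 : CascadeWaveletData 1 1} {S : CascadeSpecs}

/-! ### §1. The quadratic transit gate inhabits the RELATIVE certificate interface -/

/-- **THE QUADRATIC TRANSIT GATE MEETS THE RELATIVE REACH INTERFACE** (`η ∈ [1/2, 9/10]`, `k ≥ 6`,
`0 ≤ ε ≤ 1/2500`): a reach–avoid certificate for `quadVF k η` on the loaded region robust to
right-derivative defects of RELATIVE size `ε (1 + ‖z‖)`, cycle time `1`, from `AinO` to `AoutO` of
`Params.reg` — tube = the energy band `quadTube η (4ε)` (`pseudo_energy_band_rel`,
`quadTube_subset_loaded`), REACH = `rel_pseudoOrbit_datO`. Design level. [folklore] -/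
def quadRelReachCertificate (hS : S.lam0 = 1) (hη : 1 / 2 ≤ S.eta) (hη2 : S.eta ≤ 9 / 10) {k : ℝ}
    (hk : 6 ≤ k) {ε : ℝ} (hε0 : 0 ≤ ε) (hε : ε ≤ 1 / 2500) :
    RelReachCertificate (quadVF k S.eta) (loadedRegion S.eta) (relMod ε) 1
      (AinO (Params.reg S hS hη)) (AoutO (Params.reg S hS hη)) where
  Tube := quadTube S.eta (4 * ε)
  Tube_closed := fun p _ => quadTube_closed S.eta (4 * ε) p 1
  Tube_zero := fun p _ => mem_quadTube_zero S.eta (4 * ε) p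
  Tube_sub := fun _ hp _ hσ =>
    quadTube_subset_loaded hS hη (by linarith only [hε0]) (by linarith only [hε]) hp hσ
  cert := by
    intro p hp σT x hσT0 hσT1 hx0 hcont _ hW
    classical
    -- a velocity selection: the certificate only needs SOME right derivative
    let w : ℝ → ℝ × ℝ := fun σ => if h : σ ∈ Ico 0 σT then (hW σ h).choose else 0
    have hderiv : ∀ σ ∈ Ico 0 σT, HasDerivWithinAt x (w σ) (Ici σ) σ := fun σ hσ => by
      simp only [w, dif_pos hσ]; exact (hW σ hσ).choose_spec.1
    have hdef : ∀ σ ∈ Ico 0 σT, ‖w σ - quadVF k S.eta (x σ)‖ ≤ ε * (1 + ‖x σ‖) := fun σ hσ => by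
      simp only [w, dif_pos hσ]; exact (hW σ hσ).choose_spec.2
    have hη1 : S.eta ≤ 1 := by linarith only [hη2]
    refine ⟨?_, fun h1 => ?_⟩
    · have hb := pseudo_energy_band_rel hη hη1 k hε0 hcont hderiv hdef σT ⟨hσT0, le_rfl⟩
      rw [hx0] at hb
      exact hb
    · subst h1
      have h0 : x 0 ∈ AinO (Params.reg S hS hη) := by rw [hx0]; exact hp
      exact ⟨1, ⟨zero_le_one, le_rfl⟩,
        rel_pseudoOrbit_datO hS hη hη2 hk hε0 hε hcont hderiv hdef h0⟩

/-! ### §2. The relative residue of the quadratic transit design ALONE implies blow-up -/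

/-- **`¬ (Clay A)` FROM THE RELATIVE RESIDUE OF THE QUADRATIC TRANSIT DESIGN** (`α > 0`,
`η ∈ [1/2, 9/10]`, `k ≥ 6`, `0 ≤ ε ≤ 1/2500`): the single structure
`RelOpenReachBound 𝒟 (Params.reg) (quadVF k η) (loadedRegion η) ε 1` — the lane's residue in
relative form, presumably FALSE for two wavelets, NOT refuted by the viscous tests (they constrain
its clock: `RelOpenReachBound.unit_le_quad`) — implies finite-time loss of regularity; the
certificate half of `ns_blowup_of_relOpenReachBound` is now the theorem `quadRelReachCertificate`.
HONEST FRAMING: an implication from a presumably uninhabited structure; NOT a claim that NS blows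
up. [folklore] -/
theorem ns_blowup_of_relQuadReachBound (hS : S.lam0 = 1) (hη : 1 / 2 ≤ S.eta)
    (hη2 : S.eta ≤ 9 / 10) {k : ℝ} (hk : 6 ≤ k) {ε : ℝ} (hε0 : 0 ≤ ε) (hε : ε ≤ 1 / 2500)
    (H : RelOpenReachBound 𝒟 (Params.reg S hS hη) (quadVF k S.eta) (loadedRegion S.eta) ε 1)
    (hα : 0 < S.alpha) : ¬ NavierStokesRegularity :=
  ns_blowup_of_relOpenReachBound H le_rfl (isOpen_loadedRegion _) zero_le_one
    (quadRelReachCertificate hS hη hη2 hk hε0 hε) hα (by linarith only [hη])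

/-- **THE CASCADE THEOREM from the relative residue of the quadratic transit design** (`α > 0`,
`η ∈ [1/2, 9/10]`, `k ≥ 6`, `0 ≤ ε ≤ 1/2500`): the tubes of `quadRelReachCertificate` are energy
bands, hence bounded (`norm_le_of_mem_quadTube`), so the assembled design has per-input `H¹⁰` control
and `energy_reaches_all_scales_of_relOpenReachBound` applies — along the seed's `H¹⁰_df`-mild
trajectory the spec's energy `E_n` is present at frequency `≥ 2ⁿ λ₀` at clocked instants
`t_n ≤ ∑_{k<n} Tmax k < S_m ≤ T_*` for EVERY `n`, and the `H¹⁰` norm is unbounded on `[0, S_m)`.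
HONEST FRAMING: an implication from a structure presumed FALSE; NOT a claim that NS blows up.
[folklore] -/
theorem energy_reaches_all_scales_of_relQuadReachBound (hS : S.lam0 = 1) (hη : 1 / 2 ≤ S.eta)
    (hη2 : S.eta ≤ 9 / 10) {k : ℝ} (hk : 6 ≤ k) {ε : ℝ} (hε0 : 0 ≤ ε) (hε : ε ≤ 1 / 2500)
    (H : RelOpenReachBound 𝒟 (Params.reg S hS hη) (quadVF k S.eta) (loadedRegion S.eta) ε 1)
    (hα : 0 < S.alpha) :
    ∃ Sm : ℝ, 0 < Sm ∧ Sm ≤ S.Tstar ∧ ∃ U : ℝ → L2C,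
      IsMildSolutionFor eulerForm (schwartzL2 (seed 𝒟 (Params.reg S hS hη))) (Ico 0 Sm) U ∧
      (∀ C : ℝ, ∃ s ∈ Ico 0 Sm, ENNReal.ofReal C < eFourierSobolevNorm 10 (U s)) ∧
      ∃ t : ℕ → ℝ, t 0 = 0 ∧ Monotone t ∧
        ∀ n, t n < Sm ∧ t n ≤ ∑ k ∈ Finset.range n, S.Tmax k ∧
          ENNReal.ofReal (S.Emin n) ≤ highFreqEnergy (S.lam n) (U (t n)) :=
  energy_reaches_all_scales_of_relOpenReachBound H rfl one_pos (isOpen_loadedRegion _) zero_le_one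
    (quadRelReachCertificate hS hη hη2 hk hε0 hε)
    (fun p _ => ⟨_, add_nonneg (Real.sqrt_nonneg _) (Real.sqrt_nonneg _), fun _ hσ _ hz =>
      norm_le_of_mem_quadTube S.eta_pos (by linarith only [hε0]) p hσ.2 hz⟩)
    hα (by linarith only [hη])

end BlockDesign

end Summit.NavierStokesRegularity.FluidComputer
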